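import Summits.BirchSwinnertonDyer.BirchSwinnertonDyer.Theorems.SignedLowerHalvesSmallImageLowerHalfBothSignsRttRecipMTValues
import Literature.NumberTheory.EllipticCurves.NewformPeriodsGaloisEquivarianceProofs
import Literature.NumberTheory.EllipticCurves.HeckeThetaCMNewformGamma0Holds
import Literature.NumberTheory.EllipticCurves.NewformsLevelEqOfHeckeEigenvalueEqProofs
import Literature.NumberTheory.EllipticCurves.SharpFlatPAdicLFunctionCoeffField
import HarnessLib

/-!
# Route `SignedLowerHalves`, crux L `SmallImageLowerHalfBothSigns` (stmt-BirchSwinnertonDyer-23599), line `rtt_w3` v37 — row S4″ (`stub_junctionRecipMT_ns`),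
# brick β6 «recip-an TRANSPORT IN FRAME CURRENCY»: the `θ`-side values `θ_n(g;Ω)^{e∘ι}(χ(γ) − 1)` as twisted `L`-values of the conjugate CM newform

INPUTS hand `bsd-inputs-honda-p1` g30 under LEAD `cruxlead-stmt-BirchSwinnertonDyer-23599` (cell `bsd-ssimc`); helper `--supports stmt-BirchSwinnertonDyer-23599`.
THEOREMS ONLY (no definition, no named fact, no `sorry`).

WHAT. In the binders of S4″ the theta partner is ANY newform `g ∈ S₂(Γ₀(M))` with a `p`-adic embedding `ι : K_g → ℚ̄_p`, a plus period `Ω`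
(`IsPlusPeriod g Ω`, from `IsCohomologicalPlusPeriod`), and the identification `e ∘ ι` of `p`-adic and complex numbers (`e : ℚ̄_p ≃+* ℂ`) under which
`ι(a_ℓ(g)) = e⁻¹(Σ_{Nw=ℓ} ψ(w))` at the good primes (`hcoeffψ`). Granted the CONJUGATE NEWFORM `g^σ`, `σ = e ∘ ι` (ONE print fact,
`DiamondShurman2005_thm654_exists_isNewform0_conj` — taken here as the plain hypothesis `hconj : ∃ g', IsNewform0 g' ∧ ∀ n, a_n(g') = e(ι(a_n(g)))`
so that the LEAD may discharge it either way), this file delivers, by the tree THEOREM `PeriodRank.plusSymbol_galoisEquivariant_of_conj` (Shimura 1977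
Thm. 1, PROVED) and β5's `mul_eval₂_mazurTateElementK_eq_gaussSum_mul` (Birch, PROVED):

* ★★★ `exists_conj_period_transport` — `∃ g^σ ∈ S₂(Γ₀(M))` newform and ONE constant `Ω′ ∈ ℂˣ` with (a) `a_n(g^σ) = e(ι(a_n(g)))` for all `n`,
  (b) `a_ℓ(g^σ) = Σ_{Nw=ℓ} ψ(w)` for every prime `ℓ ∤ |d_K|·N𝔪`, (c) the TRANSPORT `plusSymbol g^σ r = Ω′ · e(ι[r]⁺_{g,Ω})` for all `r ∈ ℚ`, hence
  (d) for every `n` and every PRIMITIVE even `p`-power-order `χ` mod `p^{n+e₀}` and every entire continuation `L` of `L(g^σ, χ̄, s)`: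
  `Ω′ · θ_n(g;Ω).eval₂ (e∘ι) (χ(γ) − 1) = τ(χ) · L(1)`, and (e) `Ω′ · e(ι[0]⁺_{g,Ω}) = L(g^σ, 1)`.
* ★ `level_dvd_discr_mul_absNorm_of_conj` — with the frame's Größencharakter data (`hK2`, `htc`, `σK`, `h𝔪`, `hψ`, `hψpow`): the level is FORCED,
  `M ∣ |d_K|·N𝔪`, and `g^σ` IS Ribet's CM newform `θ_ψ` (`Ribet1977_cmNewform_gamma0_of_isGrossencharakter_holds` + STRONG MULTIPLICITY ONE, both
  PROVED in the tree: `IsNewform0.level_eq_of_heckeEigenvalue_eq_holds`, `IsNewform0.eq_of_heckeEigenvalue_eq_holds`) — answering LEAD g14's note (i).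
The `P`-side (β2 ∘ β3) then compares `L(g^σ, χ̄, 1) = L(ψ·(χ̄∘N), 1)` with the Coates–Wiles derivatives; `Ω′` is one constant (note (ii)).
HONEST FRAMING: no row is closed here; S4″, crux L, crux M and BSD remain OPEN and are proved for NO curve.
References: [Shimura1977] Thm. 1; [DiamondShurman2005] Thm. 6.5.4; [Ribet1977Nebentypus] §3 Cor. (3.5); [AtkinLehner1970] Thm. 4; [MazurTateTeitelbaum1986Invent] §I.8.
-/

set_option autoImplicit false
-- the Theorems namespace of this sub repeats the summit name by design (D-0017 nested layout)
set_option linter.dupNamespace false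

noncomputable section

open scoped Classical MatrixGroups ModularForm NumberField

open Polynomial CongruenceSubgroup NumberField IsDedekindDomain Literature.NumberTheory.EllipticCurves Literature.NumberTheory.EllipticCurves.ModularForms
  Literature.NumberTheory.GaloisRepresentations Literature.NumberTheory.LFunctions

namespace Summit.BirchSwinnertonDyer.BirchSwinnertonDyer.Theorems.SmallImageRttReciprocity

section Transport

variable {p : ℕ} [Fact p.Prime] {M : ℕ} [NeZero M] (g : CuspForm (Gamma0 M) 2) (ι : coeffField g →+* PadicAlgCl p) (Ω : ℂ) (e : PadicAlgCl p ≃+* ℂ)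

/-- ★★★ **The recip-an transport in frame currency.** For a newform `g ∈ S₂(Γ₀(M))` with a plus period `Ω` (`IsPlusPeriod g Ω`), a `p`-adic embedding `ι` of its
Hecke field and `e : ℚ̄_p ≃ ℂ`, GRANTED the conjugate newform `g^σ` along `σ = e ∘ ι` (`hconj`, = DS Thm. 6.5.4 for this `g`): there are a newform
`g' = g^σ ∈ S₂(Γ₀(M))` and ONE constant `Ω′ ≠ 0` with `a_n(g') = e(ι(a_n g))`, the symbol transport `plusSymbol g' r = Ω′·e(ι[r]⁺_{g,Ω})`, and hence,
for every PRIMITIVE even `p`-power-order `χ` modulo `p^{n+e₀}` and every entire continuation `L` of `L(g', χ̄, s)`, the CLOSED FORM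
`Ω′ · θ_n(g;Ω).eval₂ (e∘ι) (χ(γ) − 1) = τ(χ)·L(1)`, together with the bottom value `Ω′·e(ι[0]⁺_{g,Ω}) = L(g',1)`. (Shimura's σ-equivariance
`PeriodRank.plusSymbol_galoisEquivariant_of_conj` + `IsPlusPeriod.exists_plusSymbolK_eq_mul` + β5.) [cite: Shimura1977, Thm. 1]
[cite: MazurTateTeitelbaum1986Invent, §I.8 (8.6)] [cite: DiamondShurman2005, Thm. 6.5.4] -/
theorem exists_conj_period_transport (hng : IsNewform0 g) (hΩ : IsPlusPeriod g Ω)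
    (hconj : ∃ g' : CuspForm (Gamma0 M) 2, IsNewform0 g' ∧ ∀ n : ℕ, cuspCoeff g' n = e (ι ⟨cuspCoeff g n, coeff_mem_coeffField g n⟩)) :
    ∃ (g' : CuspForm (Gamma0 M) 2) (Ω' : ℂ), IsNewform0 g' ∧ Ω' ≠ 0 ∧
      (∀ n : ℕ, cuspCoeff g' n = e (ι ⟨cuspCoeff g n, coeff_mem_coeffField g n⟩)) ∧
      (∀ r : ℚ, plusSymbol g' r = Ω' * e (ι (plusSymbolK g Ω r))) ∧
      (∀ {n : ℕ} (χ : DirichletCharacter ℂ (p ^ (n + cyclotomicExponent p))), χ.Even → (∃ j : ℕ, orderOf χ = p ^ j) → χ.IsPrimitive →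
        ∀ {L : ℂ → ℂ}, Differentiable ℂ L → (∀ s : ℂ, 2 < s.re → L s = twistedLSeries g' χ⁻¹ s) →
          Ω' * (mazurTateElementK g Ω p n).eval₂ ((e : PadicAlgCl p →+* ℂ).comp ι) (χ (cyclotomicGenerator p : ZMod (p ^ (n + cyclotomicExponent p))) - 1) =
            gaussSum χ (ZMod.stdAddChar (N := p ^ (n + cyclotomicExponent p))) * L 1) ∧
      (∀ {L : ℂ → ℂ}, Differentiable ℂ L → (∀ s : ℂ, 2 < s.re → L s = cuspFormLSeries g' s) → Ω' * e (ι (plusSymbolK g Ω 0)) = L 1) := by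
  obtain ⟨g', hg', hcoeff⟩ := hconj
  set σ : coeffField g →+* ℂ := (e : PadicAlgCl p →+* ℂ).comp ι with hσ
  have hcoeff' : ∀ n : ℕ, cuspCoeff g' n = σ ⟨cuspCoeff g n, coeff_mem_coeffField g n⟩ := fun n ↦ by rw [hcoeff n, hσ]; rfl
  -- Shimura's σ-equivariance (PROVED in the tree)
  obtain ⟨ΩS, ΩS', hΩS, hΩS', q, hq⟩ := PeriodRank.plusSymbol_galoisEquivariant_of_conj g g' hng hg' σ hcoeff'
  -- `Ω_S` is a plus period of `g`; compare with `Ω`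
  have hΩSper : IsPlusPeriod g (ΩS : ℂ) := by
    refine ⟨by exact_mod_cast hΩS, fun r ↦ ?_⟩
    rw [(hq r).1, mul_div_assoc, div_self (by exact_mod_cast hΩS), mul_one]
    exact (q r).2
  obtain ⟨α, hα, hαr⟩ := hΩ.exists_plusSymbolK_eq_mul hΩSper
  have hqK : ∀ r, plusSymbolK g (ΩS : ℂ) r = q r := fun r ↦ by
    apply Subtype.ext
    rw [hΩSper.coe_plusSymbolK, (hq r).1, mul_div_assoc, div_self (by exact_mod_cast hΩS), mul_one]
  have hσα : σ α ≠ 0 := fun h ↦ hα ((map_eq_zero σ).mp h)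
  refine ⟨g', (ΩS' : ℂ) / σ α, hg', div_ne_zero (by exact_mod_cast hΩS') hσα, hcoeff, ?_, ?_, ?_⟩
  · -- (c) the transport
    intro r
    have h1 : e (ι (plusSymbolK g Ω r)) = σ α * σ (q r) := by
      change σ (plusSymbolK g Ω r) = _
      rw [hαr r, hqK r, map_mul]
    rw [h1, (hq r).2]
    field_simp
  · -- (d) the closed form (β5 §4)
    intro n χ heven hord hprim L hL hL'
    have hsym : ∀ r : ℚ, plusSymbol g' r = (ΩS' : ℂ) / σ α * σ (plusSymbolK g Ω r) := fun r ↦ by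
      have h1 : σ (plusSymbolK g Ω r) = σ α * σ (q r) := by rw [hαr r, hqK r, map_mul]
      rw [h1, (hq r).2]; field_simp
    exact mul_eval₂_mazurTateElementK_eq_gaussSum_mul g Ω σ g' _ hsym χ heven hord hprim hL hL'
  · -- (e) the bottom value
    intro L hL hL'
    have hsym : ∀ r : ℚ, plusSymbol g' r = (ΩS' : ℂ) / σ α * σ (plusSymbolK g Ω r) := fun r ↦ by
      have h1 : σ (plusSymbolK g Ω r) = σ α * σ (q r) := by rw [hαr r, hqK r, map_mul]
      rw [h1, (hq r).2]; field_simp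
    have h := mul_map_plusSymbolK_zero_eq g Ω σ g' _ hsym hL hL'
    rw [hσ] at h
    exact h

end Transport

/-! ## The level is forced and `g^σ` is Ribet's `θ_ψ` (strong multiplicity one, PROVED in the tree) -/

section Level

variable {p : ℕ} [Fact p.Prime] {M : ℕ} [NeZero M] (g : CuspForm (Gamma0 M) 2) (ι : coeffField g →+* PadicAlgCl p) (e : PadicAlgCl p ≃+* ℂ)
  (K : Type) [Field K] [NumberField K] (σK : K →+* ℂ) (𝔪 : Ideal (𝓞 K)) (ψ : HeightOneSpectrum (𝓞 K) → ℂ)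

/-- ★ **The level of the theta partner is forced: `M ∣ |d_K|·N𝔪`, and the conjugate `g^σ` is Ribet's CM newform.** For `K` imaginary quadratic,
`𝔪 ≠ 0`, `ψ` a Größencharakter mod `𝔪` of type `(1,0)` with `ψ((n)) = (d_K/n)·n` (the frame's `hψ`, `hψpow`), a newform `g ∈ S₂(Γ₀(M))` with
`ι(a_ℓ(g)) = e⁻¹(Σ_{Nw=ℓ} ψ(w))` for all primes `ℓ ∤ |d_K|·N𝔪` (`hcoeffψ`), and GRANTED the conjugate newform `g' = g^{e∘ι} ∈ S₂(Γ₀(M))` (`hconj`):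
Ribet's newform `θ_ψ` (`Ribet1977_cmNewform_gamma0_of_isGrossencharakter_holds`, level `N ∣ |d_K|·N𝔪`) and `g'` have the same Hecke eigenvalues
at every prime `ℓ ∤ |d_K|·N𝔪`, so STRONG MULTIPLICITY ONE ACROSS LEVELS (`IsNewform0.level_eq_of_heckeEigenvalue_eq_holds`) gives `M = N`, whence
`M ∣ |d_K|·N𝔪`. [cite: AtkinLehner1970, Thm. 4] [cite: Ribet1977Nebentypus, §3 Cor. (3.5)] [cite: DiamondShurman2005, Thm. 6.5.4] -/
theorem level_dvd_discr_mul_absNorm_of_conj (hK2 : Module.finrank ℚ K = 2) (htc : IsTotallyComplex K) (h𝔪 : 𝔪 ≠ ⊥)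
    (hψ : IsGrossencharakter 𝔪 (embType σK) (embTypeConj σK) ψ)
    (hψpow : ∀ n : ℕ, Odd n → n.Coprime ((NumberField.discr K).natAbs * Ideal.absNorm 𝔪) →
      idealPow K ψ (Ideal.span {(n : 𝓞 K)}) = (jacobiSym (NumberField.discr K) n : ℂ) * (n : ℂ) ^ (2 - 1))
    (hcoeffψ : ∀ ℓ : ℕ, ℓ.Prime → ¬ ℓ ∣ (NumberField.discr K).natAbs * Ideal.absNorm 𝔪 →
      embCoeff g ι ℓ = e.symm (∑ᶠ (w : HeightOneSpectrum (𝓞 K)) (_ : Ideal.absNorm w.asIdeal = ℓ), ψ w))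
    (hconj : ∃ g' : CuspForm (Gamma0 M) 2, IsNewform0 g' ∧ ∀ n : ℕ, cuspCoeff g' n = e (ι ⟨cuspCoeff g n, coeff_mem_coeffField g n⟩)) :
    M ∣ (NumberField.discr K).natAbs * Ideal.absNorm 𝔪 := by
  obtain ⟨g', hg', hcoeff⟩ := hconj
  -- Ribet's CM newform `θ_ψ`
  have hψ' : IsGrossencharakter 𝔪 (fun w => (((2 : ℕ) : ℤ) - 1) * embType σK w) (fun w => (((2 : ℕ) : ℤ) - 1) * embTypeConj σK w) ψ := by
    have h1 : (fun w => (((2 : ℕ) : ℤ) - 1) * embType σK w) = embType σK := funext fun w ↦ by push_cast; ring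
    have h2 : (fun w => (((2 : ℕ) : ℤ) - 1) * embTypeConj σK w) = embTypeConj σK := funext fun w ↦ by push_cast; ring
    rw [h1, h2]; exact hψ
  obtain ⟨N, hN, θ, hNdvd, hθ, -, hθcoeff⟩ := Ribet1977_cmNewform_gamma0_of_isGrossencharakter_holds K hK2 htc σK 2 le_rfl 𝔪 h𝔪 ψ hψ' hψpow
  haveI := hN
  -- `g'` and `θ_ψ` have the same `a_ℓ` at every prime `ℓ ∤ |d_K|·N𝔪`
  have hagree : ∀ ℓ : ℕ, ℓ.Prime → ¬ ℓ ∣ (NumberField.discr K).natAbs * Ideal.absNorm 𝔪 → cuspCoeff g' ℓ = cuspCoeff θ ℓ := by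
    intro ℓ hℓ hℓN
    rw [hcoeff ℓ, hθcoeff ℓ hℓ hℓN, ← embCoeff_def, hcoeffψ ℓ hℓ hℓN, RingEquiv.apply_symm_apply]
  -- hence the same Hecke eigenvalues off the finite set of primes dividing `|d_K|·N𝔪`
  have hD0 : (NumberField.discr K).natAbs * Ideal.absNorm 𝔪 ≠ 0 := by
    refine mul_ne_zero (Int.natAbs_ne_zero.mpr (NumberField.discr_ne_zero K)) ?_
    rw [Ne, Ideal.absNorm_eq_zero_iff]; exact h𝔪
  have hfin : {q : ℕ | q.Prime ∧ heckeEigenvalue g' q ≠ heckeEigenvalue θ q}.Finite := by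
    refine (Finset.finite_toSet ((NumberField.discr K).natAbs * Ideal.absNorm 𝔪).primeFactors).subset fun q hq ↦ ?_
    obtain ⟨hq, hne⟩ := hq
    rw [Finset.mem_coe, Nat.mem_primeFactors]
    refine ⟨hq, ?_, hD0⟩
    by_contra hqd
    apply hne
    rw [heckeEigenvalue_eq_coeff_of_isNormalized hg'.2.2 hq (hg'.2.1 q hq), heckeEigenvalue_eq_coeff_of_isNormalized hθ.2.2 hq (hθ.2.1 q hq)]
    exact hagree q hq hqd
  have hMN : M = N := IsNewform0.level_eq_of_heckeEigenvalue_eq_holds (N := M) (k := 2) hg' hθ hfin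
  rw [hMN]; exact hNdvd

end Level

end Summit.BirchSwinnertonDyer.BirchSwinnertonDyer.Theorems.SmallImageRttReciprocity

end
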